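import Mathlib.RingTheory.Localization.Ideal
import Mathlib.RingTheory.Localization.AtPrime.Basic
import Mathlib.RingTheory.Localization.Away.Basic
import Mathlib.RingTheory.Noetherian.Basic
import HarnessLib

/-!
# Crux `FrobeniusLadder.FRationalResolution` (stmt-ResolutionOfSingularities-15317), line `redirect`,
# stub `stub_diagonalizableQuotientResolution` — **an ideal that is radical at a prime is radical on a basic open
# neighbourhood** (design C3 = the rank-2 stratum layer of the non-isolated case, memo MEMO-15317-leafhand2-g10 §2
# (L3-a): with `…FixedStratumCentre.isRadical_map_span_chain` — the chain ideal is radical AT the fixed point — this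
# spreads radicality to an open neighbourhood, where the chain ideal sheaf is then the REDUCED ideal of its zero set,
# i.e. the intrinsic centre `𝓘_{Sing}` read on the chart)

* **`exists_isRadical_map_away`** — `C` Noetherian, `J` an ideal, `𝔓` a prime with `J·C_𝔓` radical ⇒ there is
  `f ∉ 𝔓` with `J·C_f` radical. Proof: `√J = (g₁, …, g_m)`; each `gᵢ ∈ √(J C_𝔓) = J C_𝔓` gives `tᵢ gᵢ ∈ J` with
  `tᵢ ∉ 𝔓`; for `f = ∏ tᵢ` one has `√(J C_f) = √J·C_f = (gᵢ)C_f ⊆ J C_f` (localization commutes with radicals,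
  `IsLocalization.map_radical`).

Honest label: generic commutative algebra toward ONE leaf stub (no stub, crux or summit closed). No definitions, no
named facts, no sorry. [cite: AtiyahMacdonald1969, Prop. 3.11 (v), Cor. 3.15] [folklore]
-/

noncomputable section

-- single-problem summit: the doubled namespace component is forced
set_option linter.dupNamespace false

namespace Summit.ResolutionOfSingularities.ResolutionOfSingularities.Theorems.FRationalResolution.FixedStratumRadicalNearby

universe u

/-- **Radical at a prime ⇒ radical on a basic open neighbourhood.** See the module docstring.
[cite: AtiyahMacdonald1969, Prop. 3.11 (v), Cor. 3.15] -/
theorem exists_isRadical_map_away {C : Type u} [CommRing C] [IsNoetherianRing C] (J : Ideal C) (𝔓 : Ideal C)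
    [𝔓.IsPrime] (hrad : (J.map (algebraMap C (Localization.AtPrime 𝔓))).IsRadical) :
    ∃ f : C, f ∉ 𝔓 ∧ (J.map (algebraMap C (Localization.Away f))).IsRadical := by
  classical
  obtain ⟨T, hT⟩ : J.radical.FG := IsNoetherian.noetherian _
  -- each generator of `√J` is in `J` after multiplying by an element outside `𝔓`
  have hgen : ∀ g ∈ T, ∃ t : C, t ∉ 𝔓 ∧ t * g ∈ J := by
    intro g hg
    have hgrad : g ∈ J.radical := by rw [← hT]; exact Ideal.subset_span hg
    have h1 : algebraMap C (Localization.AtPrime 𝔓) g ∈ J.map (algebraMap C (Localization.AtPrime 𝔓)) := by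
      apply hrad
      rw [← IsLocalization.map_radical 𝔓.primeCompl (Localization.AtPrime 𝔓) J]
      exact Ideal.mem_map_of_mem _ hgrad
    obtain ⟨⟨i, s⟩, his⟩ :=
      (IsLocalization.mem_map_algebraMap_iff 𝔓.primeCompl (Localization.AtPrime 𝔓)).1 h1
    obtain ⟨c, hc⟩ := (IsLocalization.eq_iff_exists 𝔓.primeCompl (Localization.AtPrime 𝔓)).1
      (show algebraMap C (Localization.AtPrime 𝔓) (g * (s : C)) = algebraMap C (Localization.AtPrime 𝔓) (i : C) by
        rw [map_mul]; exact his)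
    refine ⟨(c : C) * (s : C), fun h => (Ideal.IsPrime.mem_or_mem inferInstance h).elim c.2 s.2, ?_⟩
    have e : (c : C) * (s : C) * g = (c : C) * (i : C) := by rw [← hc]; ring
    rw [e]
    exact Ideal.mul_mem_left _ _ i.2
  choose! t ht using hgen
  refine ⟨∏ g ∈ T, t g, ?_, ?_⟩
  · -- `f ∉ 𝔓`
    have : (∏ g ∈ T, t g) ∈ 𝔓.primeCompl := prod_mem fun g hg => (ht g hg).1
    exact this
  · -- `J C_f` is radical
    set S := Localization.Away (∏ g ∈ T, t g) with hS
    intro y hy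
    rw [← IsLocalization.map_radical (Submonoid.powers (∏ g ∈ T, t g)) S J, ← hT, Ideal.map_span] at hy
    refine (Ideal.span_le.2 ?_) hy
    rintro _ ⟨g, hg, rfl⟩
    -- `t g` divides `f`, hence is a unit in `C_f`
    have hunitf : IsUnit (algebraMap C S (∏ g' ∈ T, t g')) := IsLocalization.Away.algebraMap_isUnit _
    have hdvd : t g ∣ ∏ g' ∈ T, t g' := Finset.dvd_prod_of_mem t hg
    obtain ⟨r, hr⟩ := hdvd
    have hunit : IsUnit (algebraMap C S (t g)) := by
      have h2 : algebraMap C S (t g) * algebraMap C S r = algebraMap C S (∏ g' ∈ T, t g') := by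
        rw [← map_mul, ← hr]
      exact isUnit_of_mul_isUnit_left (by rw [h2]; exact hunitf)
    obtain ⟨v, hv⟩ := hunit
    have key : algebraMap C S g = algebraMap C S (t g * g) * ↑v⁻¹ := by
      rw [map_mul, ← hv, mul_comm (↑v : S) _, mul_assoc, Units.mul_inv, mul_one]
    change algebraMap C S g ∈ J.map (algebraMap C S)
    rw [key]
    exact Ideal.mul_mem_right _ _ (Ideal.mem_map_of_mem _ (ht g hg).2)

end Summit.ResolutionOfSingularities.ResolutionOfSingularities.Theorems.FRationalResolution.FixedStratumRadicalNearby

end
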